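import Summits.HodgeConjecture.HodgeConjecture.Theorems.HeckePrymWeilHeckePrymAnchorsSurfaceProductStep
import Literature.AlgebraicGeometry.HodgeTheory.WeilClassesDescendingHolds
import Literature.AlgebraicGeometry.HodgeTheory.WeilClassesRationalPlane
import Literature.AlgebraicGeometry.HodgeTheory.HyperbolicWeilTypeBalanced
import Literature.AlgebraicGeometry.HodgeTheory.WeilClassesSixfoldsProofs
import Literature.AlgebraicGeometry.HodgeTheory.LefschetzOneOneHolds
import Literature.AlgebraicGeometry.Motives.AbelianVarietyCohomologyExteriorH1
import HarnessLib

/-!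
# Crux `HeckePrymAnchors` (stmt-HodgeConjecture-14496), line `Sketch` v17 · stub A `stub_aimedStep`

Route `HeckePrymWeil`, continuation lead c11. ONE STEP of the chain of aimed products
(`seedChain` / `hyperbolicTargets` of the skeleton `Lines/Sketch.lean`): for `p ≡ 3 (4)` prime
`≥ 7`, `j ≥ 1`, and a complex abelian `2j`-fold `(P, ψ)`, `ψ ≫ ψ = -p`, carrying a non-zero rational
`(j,j)` class in its strong Weil plane `weilClassesOf P ψ j p`, the whole plane being ALGEBRAIC,
there is a complex abelian `2(j+1)`-fold `(T, θ)`, `θ ≫ θ = -p`, with a projective embedding `e` and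
a rational `a ≠ 0` making `(T, θ)` of HYPERBOLIC Weil type in half-dimension `j + 1` for the
`K`-symmetrised hyperplane class `p·e^*a + θ^*e^*a`, whose strong Weil plane is algebraic and
contains a non-zero rational `(j+1,j+1)` class.

Proof. `T := P × A₂`, `θ := ψ × φ₂` for the CM-square Weil surface `(A₂, φ₂)` and the weighted
Segre class of the tree's PROVED aiming lemma
`exists_weilTypeSurface_prod_isHyperbolicWeilType_all_holds` (`HodgeTheory/WeilClassesDescendingHolds`;
Markman §11.5 Step 2, van Geemen 5.2–5.4), which also hands over the Weil classes `u± ≠ 0` of `A₂`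
with `u₊ + u₋` rational of type `(1,1)`.
* `dim T = 2(j+1)` (`dim_prod_eq_two_mul`), `θ ≫ θ = -p` (`prodLift_comp_self_eq_neg_nsmul`).
* The strong Weil plane of the SURFACE `A₂` is algebraic: `u₊ + u₋` lies in it, is algebraic by
  Lefschetz `(1,1)` (`lefschetzOneOne_rational_holds`), and is non-zero (`u±` are eigenvectors of
  `(𝟙 + φ₂)^*` for the distinct eigenvalues `(1 ± i√p)²`, `weilClassesPlus/Minus_le_eigenspace_id_add`);
  "one non-zero algebraic Weil class suffices"
  (`weilClassesOf_le_algebraicClasses_iff_exists_ne_zero_of_dim_eq`, fed with the discharged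
  `Motives.abelianVarietyCohomologyExteriorH1_holds`).
* The strong Weil plane of `T` is algebraic: the landed product step
  `stub_surfaceProductStep_of_exteriorH1 Motives.abelianVarietyCohomologyExteriorH1_holds`.
* The class on `T`: the Weil plane is a rational plane, so it contains a non-zero rational class
  (`exists_isRationalClass_ne_zero_mem_weilClassesOf`), of type `(j+1,j+1)` because hyperbolic ⇒
  balanced (`isOfHodgeType_of_mem_weilClassesOf_of_isHyperbolicWeilType`, Deligne's "(b) ⇒ (4.4)").
No definition, no named fact, no `sorry`.
-/

noncomputable section

-- every declaration of this problem lives in `Summit.HodgeConjecture.HodgeConjecture.…` (summit = sub-problem)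
set_option linter.dupNamespace false

open CategoryTheory AlgebraicGeometry Limits MonoidalCategory CartesianMonoidalCategory

namespace Summit.HodgeConjecture.HodgeConjecture.Theorems.HeckePrymWeilLine

open Literature.AlgebraicGeometry Literature.AlgebraicGeometry.Motives Literature.AlgebraicGeometry.HodgeTheory
open Literature.AlgebraicTopology.SingularHomology

/-- Two eigenvectors of one endomorphism for different eigenvalues with zero sum are zero.
[folklore] -/
private theorem as_eq_zero_of_mem_eigenspace_of_add_eq_zero {M : Type*} [AddCommGroup M]
    [Module ℂ M] (T : Module.End ℂ M) {μ ν : ℂ} (hμν : μ ≠ ν) {u v : M}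
    (hu : u ∈ Module.End.eigenspace T μ) (hv : v ∈ Module.End.eigenspace T ν) (h : u + v = 0) :
    u = 0 := by
  rw [Module.End.mem_eigenspace_iff] at hu hv
  have hv' : v = -u := by rw [← sub_eq_zero, sub_neg_eq_add, add_comm, h]
  subst hv'
  rw [map_neg, smul_neg, hu, neg_inj] at hv
  have h2 : (μ - ν) • u = 0 := by rw [sub_smul, hv, sub_self]
  rcases smul_eq_zero.1 h2 with h3 | h3
  · exact absurd (sub_eq_zero.1 h3) hμν
  · exact h3

/-- The two Weil characters of `𝟙 + φ` on a surface differ: `(1 + i√p)² ≠ (1 - i√p)²` for `p ≥ 1`.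
[folklore] -/
private theorem as_one_add_I_mul_sqrt_sq_ne (p : ℕ) (hp : 0 < p) :
    (1 + Complex.I * (Real.sqrt p : ℂ)) ^ (2 * 1) ≠ (1 - Complex.I * (Real.sqrt p : ℂ)) ^ (2 * 1) := by
  intro h
  have hs : (Real.sqrt p : ℂ) ≠ 0 := by
    have : (0 : ℝ) < Real.sqrt p := Real.sqrt_pos.2 (by exact_mod_cast hp)
    exact_mod_cast this.ne'
  have h4 : (4 : ℂ) * (Complex.I * (Real.sqrt p : ℂ)) = 0 := by linear_combination h
  simp [Complex.I_ne_zero, hs] at h4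

/-- **Stub A (the aimed product step)**: for `p ≡ 3 (4)` prime `≥ 7`, `j ≥ 1`, and a complex
abelian `2j`-fold `(P, ψ)`, `ψ ≫ ψ = -p`, with a non-zero rational `(j,j)` class in its strong Weil
plane and ALGEBRAIC strong Weil plane, there is a complex abelian `2(j+1)`-fold `(T, θ)`,
`θ ≫ θ = -p` — namely `P × A₂` for the aimed CM square `A₂` of
`exists_weilTypeSurface_prod_isHyperbolicWeilType_all_holds` — with a projective embedding `e` and a
rational `a ≠ 0` making `(T, θ)` of HYPERBOLIC Weil type in half-dimension `j + 1` for
`p·e^*a + θ^*e^*a`, whose strong Weil plane is algebraic (Lefschetz `(1,1)` +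
`weilClassesOf_le_algebraicClasses_iff_exists_ne_zero_of_dim_eq` for the partner surface, then the
product step `stub_surfaceProductStep_of_exteriorH1 abelianVarietyCohomologyExteriorH1_holds`) and
contains a non-zero rational `(j+1,j+1)` class (`exists_isRationalClass_ne_zero_mem_weilClassesOf`,
hyperbolic ⇒ balanced `isOfHodgeType_of_mem_weilClassesOf_of_isHyperbolicWeilType`).
[cite: Markman2025SurveySecant, §11.5 Step 2] [cite: vanGeemen1994HodgeAV, Lemma 5.2, 5.3–5.4] -/
theorem stub_aimedStep :
    ∀ p : ℕ, p.Prime → p % 4 = 3 → 7 ≤ p → ∀ j : ℕ, 0 < j → ∀ (P : AbelianVariety ℂ) (ψ : P ⟶ P),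
      P.dim = 2 * j → ψ ≫ ψ = -(p • 𝟙 P) →
      (∃ c ∈ weilClassesOf P ψ j p, IsRationalClass c ∧ IsOfHodgeType (2 * j) P.X (2 * j) j j c ∧ c ≠ 0) →
      weilClassesOf P ψ j p ≤ algebraicClasses P.X j →
      ∃ (T : AbelianVariety ℂ) (θ : T ⟶ T) (e : ProjectiveEmbedding T.X)
        (a : complexBetti (projectiveSpace e.n ℂ) 2),
        T.dim = 2 * (j + 1) ∧ θ ≫ θ = -(p • 𝟙 T) ∧ IsRationalClass a ∧ a ≠ 0 ∧
        IsHyperbolicWeilType T θ (j + 1)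
          ((p : ℂ) • complexBetti.map e.ι 2 a + complexBetti.map θ.hom.hom.hom 2 (complexBetti.map e.ι 2 a)) ∧
        weilClassesOf T θ (j + 1) p ≤ algebraicClasses T.X (j + 1) ∧
        (∃ c ∈ weilClassesOf T θ (j + 1) p, IsRationalClass c ∧
          IsOfHodgeType (2 * (j + 1)) T.X (2 * (j + 1)) (j + 1) (j + 1) c ∧ c ≠ 0) := by
  intro p hp hp4 hp7 j hj P ψ hP hψ hc halg
  have hp0 : 0 < p := hp.pos
  obtain ⟨c, hcW, hcr, hcH, hc0⟩ := hc
  -- the aimed CM square `A₂` and the weighted Segre class making `P × A₂` hyperbolic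
  obtain ⟨A₂, φ₂, hA₂, hA₂sp, hφ₂, ⟨up, um, hup, hum, hrat, hH11, hup0, -, -⟩, e, a, ha, ha0, hhyp⟩ :=
    exists_weilTypeSurface_prod_isHyperbolicWeilType_all_holds j hj p hp0 P ψ hP
      (Motives.isSmoothProjective_of_dim_eq' hP) hψ ⟨c, hcr, hcH, hcW, hc0⟩
  have hT : (P.prod A₂).dim = 2 * (j + 1) := dim_prod_eq_two_mul hP hA₂
  have hθ := prodLift_comp_self_eq_neg_nsmul hψ hφ₂
  -- the strong Weil plane of the partner surface is algebraic (Lefschetz `(1,1)` on `u₊ + u₋ ≠ 0`)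
  have hA₂alg : weilClassesOf A₂ φ₂ 1 p ≤ algebraicClasses A₂.X 1 := by
    refine (weilClassesOf_le_algebraicClasses_iff_exists_ne_zero_of_dim_eq
      Motives.abelianVarietyCohomologyExteriorH1_holds hA₂ one_pos hp0 hφ₂).2 ⟨up + um, ?_, ?_, ?_⟩
    · exact Submodule.add_mem _ (Submodule.mem_sup_left hup) (Submodule.mem_sup_right hum)
    · exact lefschetzOneOne_rational_holds hA₂sp (up + um) hrat hH11
    · intro h0
      exact hup0 (as_eq_zero_of_mem_eigenspace_of_add_eq_zero _ (as_one_add_I_mul_sqrt_sq_ne p hp0)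
        (weilClassesPlus_le_eigenspace_id_add φ₂ 1 p hup)
        (weilClassesMinus_le_eigenspace_id_add φ₂ 1 p hum) h0)
  -- the strong Weil plane of the product is algebraic (the landed product step)
  have hTalg : weilClassesOf (P.prod A₂)
      (AbelianVariety.prodLift (AbelianVariety.fst P A₂ ≫ ψ) (AbelianVariety.snd P A₂ ≫ φ₂))
      (j + 1) p ≤ algebraicClasses (P.prod A₂).X (j + 1) :=
    stub_surfaceProductStep_of_exteriorH1 Motives.abelianVarietyCohomologyExteriorH1_holds p hp hp4
      hp7 j P ψ A₂ φ₂ hP (by omega) (by rw [hψ, natCast_zsmul]) (by rw [hφ₂, natCast_zsmul]) halg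
      hA₂alg
  -- a non-zero rational class of the Weil plane of the product, of type `(j+1,j+1)` (balanced)
  obtain ⟨c', hc'W, hc'0, hc'r⟩ :=
    exists_isRationalClass_ne_zero_mem_weilClassesOf (Nat.succ_pos j) hT hp0 hθ
  exact ⟨P.prod A₂, _, e, a, hT, hθ, ha, ha0, hhyp, hTalg, c', hc'W, hc'r,
    isOfHodgeType_of_mem_weilClassesOf_of_isHyperbolicWeilType (Nat.succ_pos j) hp0 hT hθ e ha ha0
      hhyp hc'W, hc'0⟩

end Summit.HodgeConjecture.HodgeConjecture.Theorems.HeckePrymWeilLine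

end
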